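import Summits.CriticalPhenomena.Ising3DConformalLimit.Theses.AnomalousForcesInteraction
import Literature.Probability.LatticeModels.CriticalTwoPointLower
import Literature.Probability.LatticeModels.SharpnessProofs
import Literature.Probability.LatticeModels.MagnetizationExponentUpper
import Literature.Probability.LatticeModels.GKSInequalities
import Literature.Probability.LatticeModels.MessagerMiracleSole
import HarnessLib

/-!
# Effective Buckingham–Gunton reduction for crux `EtaPositive` (stmt-CriticalPhenomena-2600)

Route `AnomalousForcesInteraction` (Ising3DConformalLimit), line `birth` ("η(3) > 0 from the critical
isotherm"). This file lands the COMPOSITION of the registered skeleton as an unconditional reduction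
theorem, in quantitative form.

* `criticalTwoPoint_decay_of_boxResponse_of_isotherm` — **effective Buckingham–Gunton inequality at
  `β_c(3)`**: granted the finite-box fluctuation–response inequality at `β_c` in a field
  (`(2R+1)³ (⟨σ₀σ_x⟩_{β_c} - m(β_c,h)²) ≤ m(β_c,h)/(β_c h)` for `3R ≤ ‖x‖_∞`; registered stub
  `stub_boxResponse`, GHS + GKS + Messager–Miracle-Solé), ANY upper critical-isotherm bound
  `m(β_c(3),h) ≤ A h^b` on `(0,h₀]` with `b > 0` gives the two-point decay
  `⟨σ₀σ_x⟩_{β_c(3)} ≤ C ‖x‖^{-6b/(b+1)}` for all `x ≠ 0`.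
  In exponent language this is `2 - η ≤ d(δ-1)/(δ+1)` at `d = 3` (Buckingham–Gunton 1969 / Fisher 1969),
  made effective: `1 + η ≥ 6/(δ+1)`. Proof: for `‖x‖ = n ≥ N₀` choose the field `h = n^{-3/(b+1)}` and the
  radius `R = ⌊n/3⌋`, so `(n³/27)(G(x) - A²h^{2b}) ≤ A h^{b-1}/β_c`, i.e.
  `G(x) ≤ (A² + 27A/β_c) n^{-6b/(b+1)}`; small `n` by `G ≤ 1`.
* `etaPositive_of_boxResponse_isothermGain` — the definiens of the crux from the two registered stub
  statements: if moreover `b > 1/5` then `6b/(b+1) = 1 + κ` with `κ = (5b-1)/(b+1) > 0`, which is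
  `EtaPositive` (the skeleton's `EtaPositive_of` is this theorem fed the two stubs).

Nothing here is conditional on a named fact; the two hypotheses are the registered stubs of the line,
fed in by the skeleton theorem `EtaPositive_of`.
-/

noncomputable section

namespace Summit.CriticalPhenomena.Ising3DConformalLimit.AnomalousForcesInteractionEtaPositive

open Literature.Probability.LatticeModels

set_option maxHeartbeats 400000 in
/-- **Effective Buckingham–Gunton inequality at `β_c(3)` (quantitative reduction).** Granted the
finite-box fluctuation–response inequality at `β_c(3)` in a field (hypothesis `hBox`, the registered
stub `stub_boxResponse` of line `birth`), an upper critical-isotherm bound `m(β_c(3),h) ≤ A h^b` on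
`(0,h₀]` with `b > 0` forces `⟨σ₀σ_x⟩⁺_{β_c(3),0} ≤ C ‖x‖^{-6b/(b+1)}` for every `x ≠ 0` (sup norm).
For `b = 1/δ` the exponent is `6/(δ+1) = 1 + η_BG` with `η_BG = (5-δ)/(δ+1)`, the equality case of
Buckingham–Gunton's `2 - η ≤ 3(δ-1)/(δ+1)`. -/
theorem criticalTwoPoint_decay_of_boxResponse_of_isotherm
    (hBox : ∀ h : ℝ, 0 < h → ∀ (R : ℕ) (x : Site 3), 3 * (R : ℝ) ≤ ‖x‖ →
      (2 * (R : ℝ) + 1) ^ 3 *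
          (criticalTwoPoint 3 x - magnetizationInField 3 (criticalBeta 3) h ^ 2) ≤
        magnetizationInField 3 (criticalBeta 3) h / (criticalBeta 3 * h))
    {b A h₀ : ℝ} (hb0 : 0 < b) (hh₀ : 0 < h₀)
    (hM : ∀ h : ℝ, 0 < h → h ≤ h₀ → magnetizationInField 3 (criticalBeta 3) h ≤ A * h ^ b) :
    ∃ C : ℝ, ∀ x : Site 3, x ≠ 0 →
      criticalTwoPoint 3 x ≤ C * (‖x‖ : ℝ) ^ (-(6 * b / (b + 1))) := by
  -- constants of the model
  have hβ : 0 < criticalBeta 3 := criticalBeta_pos_holds (d := 3) (by norm_num)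
  have hm0 : ∀ h : ℝ, 0 ≤ h → 0 ≤ magnetizationInField 3 (criticalBeta 3) h := fun h hh => by
    rw [magnetizationInField_eq_plusCorr]
    exact plusCorr_nonneg (d := 3) hβ.le hh _
  have hG1 : ∀ x : Site 3, criticalTwoPoint 3 x ≤ 1 := fun x =>
    twoPointPlus_le_one_of_nonneg (criticalBeta_nonneg 3) x
  -- normalised amplitude `A' ≥ 1`
  set A' : ℝ := max A 1 with hA'def
  have hA'1 : 1 ≤ A' := le_max_right _ _
  have hA'0 : 0 < A' := one_pos.trans_le hA'1
  have hAA' : A ≤ A' := le_max_left _ _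
  -- exponents: target exponent `1 + κ = 6b/(b+1)`, optimising field exponent `e = 3/(b+1)`
  have hb1 : 0 < b + 1 := by linarith
  have hb1ne : b + 1 ≠ 0 := hb1.ne'
  set κ : ℝ := (5 * b - 1) / (b + 1) with hκdef
  have hκ1 : 0 ≤ 1 + κ := by
    have : 1 + κ = 6 * b / (b + 1) := by rw [hκdef]; field_simp; ring
    rw [this]; positivity
  have hκeq : -(6 * b / (b + 1)) = -(1 + κ) := by rw [hκdef]; field_simp; ring
  rw [hκeq]
  set e : ℝ := 3 / (b + 1) with hedef
  have he0 : 0 < e := div_pos (by norm_num) hb1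
  have hene : e ≠ 0 := he0.ne'
  have h2eb : -e * b + -e * b = -(1 + κ) := by
    rw [hedef, hκdef]; field_simp; ring
  have heb3 : -e * (b - 1) + -(3 : ℝ) = -(1 + κ) := by
    rw [hedef, hκdef]; field_simp; ring
  -- the threshold beyond which the optimising field is admissible (`h ≤ h₀`) and `‖x‖ ≥ 3`
  set N₀ : ℝ := max 3 (h₀ ^ (-(1 / e))) with hN₀def
  have hN₀3 : (3 : ℝ) ≤ N₀ := le_max_left _ _
  have hN₀0 : 0 < N₀ := lt_of_lt_of_le (by norm_num) hN₀3
  -- the two constants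
  set K₁ : ℝ := A' ^ 2 + 27 * A' / criticalBeta 3 with hK₁def
  have hK₁0 : 0 ≤ K₁ := by positivity
  set K₂ : ℝ := N₀ ^ (1 + κ) with hK₂def
  have hK₂0 : 0 ≤ K₂ := Real.rpow_nonneg hN₀0.le _
  refine ⟨K₁ + K₂, fun x hx => ?_⟩
  -- `n = ‖x‖ ≥ 1`
  set n : ℝ := ‖x‖ with hndef
  have hn1 : 1 ≤ n := by
    rw [hndef, Site.norm_eq_supNorm]
    have h0 : Site.supNorm x ≠ 0 := fun h => hx (Site.supNorm_eq_zero_iff.1 h)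
    exact_mod_cast Nat.one_le_iff_ne_zero.2 h0
  have hn0 : 0 < n := one_pos.trans_le hn1
  have ht0 : 0 ≤ n ^ (-(1 + κ)) := Real.rpow_nonneg hn0.le _
  by_cases hlarge : N₀ ≤ n
  · -- MAIN CASE: `n ≥ N₀ ≥ 3`; field `h = n^{-e}`, radius `R = ⌊n/3⌋`
    have hn3 : 3 ≤ n := hN₀3.trans hlarge
    set h : ℝ := n ^ (-e) with hhdef
    have hh0 : 0 < h := Real.rpow_pos_of_pos hn0 _
    have hhne : h ≠ 0 := hh0.ne'
    have hhh₀ : h ≤ h₀ := by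
      have hy0 : 0 < h₀ ^ (-(1 / e)) := Real.rpow_pos_of_pos hh₀ _
      have hyn : h₀ ^ (-(1 / e)) ≤ n := (le_max_right _ _).trans hlarge
      have h1 : n ^ (-e) ≤ (h₀ ^ (-(1 / e))) ^ (-e) :=
        Real.rpow_le_rpow_of_nonpos hy0 hyn (by linarith)
      have h2 : (h₀ ^ (-(1 / e))) ^ (-e) = h₀ := by
        rw [← Real.rpow_mul hh₀.le]
        have : -(1 / e) * -e = 1 := by field_simp
        rw [this, Real.rpow_one]
      rw [hhdef]
      exact h1.trans h2.le
    set R : ℕ := ⌊n / 3⌋₊ with hRdef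
    have hR3 : 3 * (R : ℝ) ≤ n := by
      have : (R : ℝ) ≤ n / 3 := Nat.floor_le (by positivity)
      linarith
    have hRbig : n / 3 ≤ 2 * (R : ℝ) + 1 := by
      have : n / 3 < (R : ℝ) + 1 := Nat.lt_floor_add_one (n / 3)
      linarith
    set P : ℝ := (2 * (R : ℝ) + 1) ^ 3 with hPdef
    have hP0 : 0 < P := by positivity
    have hPne : P ≠ 0 := hP0.ne'
    have hPn : n ^ 3 / 27 ≤ P := by
      have h1 : (n / 3) ^ 3 ≤ (2 * (R : ℝ) + 1) ^ 3 := pow_le_pow_left₀ (by positivity) hRbig 3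
      have h2 : (n / 3) ^ 3 = n ^ 3 / 27 := by ring
      rw [hPdef, ← h2]; exact h1
    -- the magnetisation at the optimising field
    set m : ℝ := magnetizationInField 3 (criticalBeta 3) h with hmdef
    have hmnn : 0 ≤ m := hm0 h hh0.le
    have hu0 : 0 < h ^ b := Real.rpow_pos_of_pos hh0 _
    have hmle : m ≤ A' * h ^ b := (hM h hh0 hhh₀).trans (mul_le_mul_of_nonneg_right hAA' hu0.le)
    have hm2 : m ^ 2 ≤ A' ^ 2 * (h ^ b) ^ 2 := by
      rw [← mul_pow]; exact pow_le_pow_left₀ hmnn hmle 2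
    -- the box inequality at `(h, R, x)` and its consequence `G(x) ≤ A'² (h^b)² + T/P`
    have hbox : P * (criticalTwoPoint 3 x - m ^ 2) ≤ m / (criticalBeta 3 * h) := hBox h hh0 R x hR3
    have hrhs : m / (criticalBeta 3 * h) ≤ A' * h ^ b / (criticalBeta 3 * h) :=
      div_le_div_of_nonneg_right hmle (by positivity)
    set T : ℝ := A' * h ^ b / (criticalBeta 3 * h) with hTdef
    have hT0 : 0 ≤ T := by positivity
    have hPG : P * criticalTwoPoint 3 x ≤ P * (A' ^ 2 * (h ^ b) ^ 2) + T := by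
      have h1 := hbox.trans hrhs
      rw [mul_sub] at h1
      have h2 := mul_le_mul_of_nonneg_left hm2 hP0.le
      linarith
    have hG : criticalTwoPoint 3 x ≤ A' ^ 2 * (h ^ b) ^ 2 + T / P := by
      have h3 : criticalTwoPoint 3 x ≤ (P * (A' ^ 2 * (h ^ b) ^ 2) + T) / P := by
        rw [le_div_iff₀ hP0]; linarith
      have h4 : (P * (A' ^ 2 * (h ^ b) ^ 2) + T) / P = A' ^ 2 * (h ^ b) ^ 2 + T / P := by
        rw [add_div, mul_div_cancel_left₀ _ hPne]
      linarith [h3, h4.le, h4.ge]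
    -- `1/P ≤ 27/n³`
    have hPinv : T / P ≤ T * (27 / n ^ 3) := by
      rw [div_eq_mul_inv]
      refine mul_le_mul_of_nonneg_left ?_ hT0
      have := inv_anti₀ (by positivity : 0 < n ^ 3 / 27) hPn
      rwa [inv_div] at this
    -- exponent bookkeeping: everything is a power of `n`
    have hn3' : n ^ 3 = n ^ (3 : ℝ) := by rw [← Real.rpow_natCast]; norm_num
    have hpow1 : (h ^ b) ^ 2 = n ^ (-(1 + κ)) := by
      rw [hhdef, ← Real.rpow_mul hn0.le, sq, ← Real.rpow_add hn0, h2eb]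
    have hpow2 : h ^ b / (criticalBeta 3 * h) * (27 / n ^ 3) = 27 / criticalBeta 3 * n ^ (-(1 + κ)) := by
      have hn3ne : n ^ 3 ≠ 0 := by positivity
      have hA : h ^ b / (criticalBeta 3 * h) * (27 / n ^ 3) =
          27 / criticalBeta 3 * (h ^ b / h * (n ^ 3)⁻¹) := by
        field_simp
      have hB : h ^ b / h = n ^ (-e * (b - 1)) := by
        rw [← Real.rpow_sub_one hhne, hhdef, ← Real.rpow_mul hn0.le]
      have hC : (n ^ 3)⁻¹ = n ^ (-(3 : ℝ)) := by
        rw [Real.rpow_neg hn0.le, hn3']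
      rw [hA, hB, hC, ← Real.rpow_add hn0, heb3]
    have h5 : T * (27 / n ^ 3) = A' * (27 / criticalBeta 3 * n ^ (-(1 + κ))) := by
      rw [hTdef, mul_div_assoc, mul_assoc, hpow2]
    have hmain : criticalTwoPoint 3 x ≤ K₁ * n ^ (-(1 + κ)) := by
      calc criticalTwoPoint 3 x ≤ A' ^ 2 * (h ^ b) ^ 2 + T * (27 / n ^ 3) :=
            hG.trans (add_le_add le_rfl hPinv)
        _ = A' ^ 2 * n ^ (-(1 + κ)) + A' * (27 / criticalBeta 3 * n ^ (-(1 + κ))) := by rw [hpow1, h5]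
        _ = K₁ * n ^ (-(1 + κ)) := by rw [hK₁def]; ring
    calc criticalTwoPoint 3 x ≤ K₁ * n ^ (-(1 + κ)) := hmain
      _ ≤ (K₁ + K₂) * n ^ (-(1 + κ)) := by nlinarith [mul_nonneg hK₂0 ht0]
  · -- SMALL CASE: `n < N₀`; `G ≤ 1 ≤ N₀^{1+κ} n^{-(1+κ)}`
    have hnN : n ≤ N₀ := (not_le.1 hlarge).le
    have h1 : N₀ ^ (-(1 + κ)) ≤ n ^ (-(1 + κ)) :=
      Real.rpow_le_rpow_of_nonpos hn0 hnN (by linarith)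
    have h2 : K₂ * N₀ ^ (-(1 + κ)) = 1 := by
      rw [hK₂def, Real.rpow_neg hN₀0.le, mul_inv_cancel₀ (Real.rpow_pos_of_pos hN₀0 _).ne']
    have h3 : 1 ≤ K₂ * n ^ (-(1 + κ)) :=
      calc (1 : ℝ) = K₂ * N₀ ^ (-(1 + κ)) := h2.symm
        _ ≤ K₂ * n ^ (-(1 + κ)) := mul_le_mul_of_nonneg_left h1 hK₂0
    calc criticalTwoPoint 3 x ≤ 1 := hG1 x
      _ ≤ K₂ * n ^ (-(1 + κ)) := h3
      _ ≤ (K₁ + K₂) * n ^ (-(1 + κ)) := by nlinarith [mul_nonneg hK₁0 ht0]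

/-- **The crux from the two registered stubs** (effective Buckingham–Gunton, contrapositive reading):
the finite-box fluctuation–response inequality at `β_c(3)` in a field (`stub_boxResponse`) and an
upper critical isotherm `m(β_c(3),h) ≤ A h^b` on `(0,h₀]` with SOME `b > 1/5` (`stub_isothermGain`,
"`1/δ > 1/5` in upper-bound form") give the definiens of `EtaPositive` with `κ = (5b-1)/(b+1) > 0`,
since `6b/(b+1) = 1 + κ`. The skeleton theorem `EtaPositive_of` of line `birth` is this theorem applied
to the two stubs (the route decl unfolds to the conclusion by `rfl`). -/
theorem etaPositive_of_boxResponse_isothermGain :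
    (∀ h : ℝ, 0 < h → ∀ (R : ℕ) (x : Site 3), 3 * (R : ℝ) ≤ ‖x‖ →
      (2 * (R : ℝ) + 1) ^ 3 *
          (criticalTwoPoint 3 x - magnetizationInField 3 (criticalBeta 3) h ^ 2) ≤
        magnetizationInField 3 (criticalBeta 3) h / (criticalBeta 3 * h)) →
    (∃ b A h₀ : ℝ, 1 / 5 < b ∧ 0 < h₀ ∧ ∀ h : ℝ, 0 < h → h ≤ h₀ →
      magnetizationInField 3 (criticalBeta 3) h ≤ A * h ^ b) →
    ∃ κ C : ℝ, 0 < κ ∧ ∀ x : Site 3, x ≠ 0 →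
      criticalTwoPoint 3 x ≤ C * (‖x‖ : ℝ) ^ (-(1 + κ)) := by
  intro hBox hIso
  obtain ⟨b, A, h₀, hb, hh₀, hM⟩ := hIso
  have hb0 : 0 < b := lt_trans (by norm_num) hb
  have hb1 : 0 < b + 1 := by linarith
  obtain ⟨C, hC⟩ := criticalTwoPoint_decay_of_boxResponse_of_isotherm hBox hb0 hh₀ hM
  refine ⟨(5 * b - 1) / (b + 1), C, div_pos (by linarith) hb1, fun x hx => ?_⟩
  have hκeq : -(1 + (5 * b - 1) / (b + 1)) = -(6 * b / (b + 1)) := by field_simp; ring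
  rw [hκeq]
  exact hC x hx

end Summit.CriticalPhenomena.Ising3DConformalLimit.AnomalousForcesInteractionEtaPositive
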